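import Summits.BirchSwinnertonDyer.BirchSwinnertonDyer.Theorems.TwoAdicConverseBDPAcLineCoinvariantControl
import Summits.BirchSwinnertonDyer.BirchSwinnertonDyer.Theorems.TwoAdicConverseBDPAcLineSpecialisationAtTwoBudget
import HarnessLib

/-!
# AC-LINE SPECIALISATION₂, the COINVARIANT DOOR (part II): the ABSTRACT COINVARIANT BOUND `p^{a+b} · A^{I′} ⊆ (φ − 1)A^{I′}`,
# its `p = 2` reading «ORDINARY SHAPE at `v̄`» (`2^{1+v}`), and the door / budget / (e15) net shapes in the coinvariant currency
# (crux `BDPSelmerLowerDivisibilityAtTwo`, stmt-BirchSwinnertonDyer-24728; route `TwoAdicConverse`, S3)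

Helper file `--supports stmt-BirchSwinnertonDyer-24728` (cell `bsd-2adic`, seat `bsd-2adic-tower-1` GEN 54; key «COINVARIANT DOOR»,
director-bsd (661), pen RC-654 §(2)–(3), SUMMON 20260830T195425Z). THEOREMS ONLY (no definition, no named fact, no instance,
no `sorry`). Part I (`…AcLineCoinvariantInfRes`, `…AcLineCoinvariantControl`) re-typed GEN 53's door `X_Gr₂ ⧸ T₁ → 𝔛_ac` in the
COINVARIANT currency: `hgen` («`φ` topologically generates `ker κ₂ ∩ D_{v̄}` modulo `I′ = pairKer κ₁ κ₂ ∩ I_{v̄}`») + `hcoinv`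
(«every `I′`-fixed `m ∈ E[p^∞]` has `p^c • m = φ • m' − m'` with `m'` fixed»). This file DISCHARGES `hcoinv` from elementary
algebra:

* §1 ★ `exists_fixed_and_mul_smul_eq_smul_sub` — THE ABSTRACT COINVARIANT BOUND (any group `G` acting on an abelian group `A`,
  `I′ ≤ G`, `φ` with `φ • A^{I′} ⊆ A^{I′}` — e.g. `φ` normalises `I′`, `smul_smul_eq_of_conj_mem` — `F ≤ A` ANY additive subgroup,
  `d q : ℕ`): if the `I′`-fixed elements of `F` are killed by `d` and for every `m` some integer multiple `j • m` has
  `φ • (j • m) − j • m − q • m ∈ F`, then every `I′`-fixed `m` has `(d·q) • m = φ • m' − m'` with `m'` fixed. PROOF (pen-checked):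
  `m₁ := j • m` is fixed, `n := φ•m₁ − m₁ − q•m ∈ F` is fixed, so `d • n = 0`, i.e. `(d·q) • m = φ • (d•m₁) − d•m₁`. NO stability of
  `F`, NO «`I′` trivial on `A/F`», NO divisibility, NO CM hypothesis is used. `p = 2` reading ★ `exists_fixed_and_two_pow_succ_smul_eq_smul_sub`:
  `(hτ : ∃ τ ∈ I′, τ|_F = −1)` gives `d = 2` (a fixed `n ∈ F` has `n = τ•n = −n`), `q = 2^v` gives `2^{v+1}`.
* §2 the curve-level discharge: `coinvExponent_of_shape` (any `p`: exponents `p^a` on `F ∩ A^{I′}` and `p^b` in the `φ`-relation ⟹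
  `hcoinv` with `c = a + b`) and ★ `coinvExponent_of_ordinaryShape` (`p = 2`: ONE displayed existential
  `hord : ∃ F ≤ E[2^∞], (∃ τ ∈ pairKer κ₁ κ₂ ∩ I_{v̄}, τ|_F = −1) ∧ ∃ v, ∀ m, ∃ j : ℤ, φ • (j • m) − j • m − 2^v • m ∈ F` ⟹ `hcoinv`
  with `c = v + 1`; `φ ∈ D_{v̄}` normalises `I′` because `pairKer ⊴ Γ_K` and `I_{v̄} ⊴ D_{v̄}`, `SignedEC.SharpEigen.inertiaIn_normal`);
  ★ `acLineControl_of_ordinaryShape` — the door's control input `hctl` at `(W.baseChange K, 2, κ₁, κ₂, v̄, γ₁)` from `hgen` + `hord`.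
* §3 the (S2)/(e15) NET SHAPES in the new currency (mechanical on GEN 53's budget file p783980, `hctl` supplied by part I / §2):
  `acLineBudget_of_rankOne_of_localCoinvExponent`, `nondeg₀_and_budget_of_rankOne_of_localCoinvExponent` (any `p`),
  `acLineBudget_of_rankOne_of_ordinaryShape`, ★ `one_add_le_of_fibrePinned_of_rankOne_of_localCoinvExponent`,
  ★ `one_add_le_of_fibrePinned_of_rankOne_of_ordinaryShape` (`p = 2`: a pinned W⁺ datum ∧ (β) rank-one ∧ hgen ∧ hord ⟹ `1 + a ≤ k + m`).

«ORDINARY SHAPE AT `v̄`» ON PAPER (displayed, NOT proved here — R3: no structural fact about `torsionFilAt` is asserted):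
`F = Ê[2^∞] = ⋃_k torsionFilAt v̄ 2^k`; `τ` = any element of `I′` with `χ_cyc(τ) = −1` (exists: `i ∉ ℚ₂^{ℤ₂²} = K̃_{∞,w̃}` and
`ℚ₂^{ℤ₂²}(i)/ℚ₂^{ℤ₂²}` is ramified; inertia acts on the height-one formal group through `χ_cyc`); `v = v₂(α^f − 1)` with `α` the
unit root of Frobenius at `v̄` and `f` the residue degree index of `φ` (`α` is no root of unity, so `v < ∞`); CM ALLOWED.
HONEST LABELS: a door is a door — NONDEG₀ / BUDGET / (e15) at (β) become «modulo `hgen` + `hord`» instead of «modulo `hfixc`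
(Serre–Tate, ¬CM)»; closes nothing at the ∀-level; the count of record of O2 does not move; U / R0G / ACPIN / OV16-print untouched;
BSD is proved for no curve by any of this; typed ≠ proved. References: Serre, *Local Fields* XIII §1; Neukirch–Schmidt–Wingberg
(1.7.7); Jetchev–Skinner–Wan, Camb. J. Math. 5 (2017) §3.4; Skinner–Urban, Invent. Math. 195 (2014) Prop. 3.2.8; Greenberg,
LNM 1716 §2 (ordinary filtration), §3 Lemmas 3.1–3.3.
-/

-- D-0017: single-problem summit, the namespace repeats the problem name by design.
set_option linter.dupNamespace false
set_option autoImplicit false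

noncomputable section

open scoped Classical

open NumberField IsDedekindDomain Field WeierstrassCurve
open Literature.NumberTheory.EllipticCurves Literature.NumberTheory.GaloisRepresentations
  Literature.NumberTheory.EllipticCurves.GreenbergSelmer Literature.NumberTheory.EllipticCurves.GreenbergVatsal2000
  Literature.NumberTheory.EllipticCurves.Castella2018 Literature.NumberTheory.EllipticCurves.TwoVariableSelmer
open Summit.BirchSwinnertonDyer.Rank1Residual
open Summit.BirchSwinnertonDyer.BirchSwinnertonDyer.Theorems.TwoAdicBDPAcControl

namespace Summit.BirchSwinnertonDyer.BirchSwinnertonDyer.Theorems.TwoAdicBDPAcLineSpec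

/-! ## §1. The ABSTRACT COINVARIANT BOUND (pure algebra, no topology) -/

section Coinv

variable {G : Type*} [Group G] {A : Type*} [AddCommGroup A] [DistribMulAction G A]

/-- If `φ` normalises `I′` (`φ⁻¹ x φ ∈ I′` for `x ∈ I′`) then `φ` maps `I′`-fixed elements to `I′`-fixed elements:
`x • φ • m = φ • (φ⁻¹xφ) • m = φ • m`. [folklore] -/
theorem smul_smul_eq_of_conj_mem (I' : Subgroup G) (φ : G) (hconj : ∀ x ∈ I', φ⁻¹ * x * φ ∈ I')
    (m : A) (hm : ∀ x ∈ I', x • m = m) (x : G) (hx : x ∈ I') : x • (φ • m) = φ • m := by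
  have h := hm _ (hconj x hx)
  calc x • (φ • m) = φ • (φ⁻¹ • (x • (φ • m))) := (smul_inv_smul φ _).symm
    _ = φ • ((φ⁻¹ * x * φ) • m) := by rw [mul_smul, mul_smul]
    _ = φ • m := by rw [h]

/-- ★ **THE ABSTRACT COINVARIANT BOUND.** Let a group `G` act on an abelian group `A`, `I′ ≤ G`, `φ ∈ G` with
`φ • A^{I′} ⊆ A^{I′}`, `F ≤ A` any additive subgroup, `d q : ℕ`. Suppose (hF) every `I′`-FIXED element of `F` is killed by `d`,
and (hu) for every `m ∈ A` there is an integer `j` with `φ • (j • m) − j • m − q • m ∈ F` («`φ` acts on `A/F` by a scalar `u`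
with `u − 1 = q · (unit)`», read element-wise). Then every `I′`-fixed `m` satisfies `(d·q) • m = φ • m' − m'` for some
`I′`-fixed `m'`: the `φ`-COINVARIANTS of `A^{I′}` are killed by `d·q`. Proof: `m₁ := j • m` is fixed; `n := φ•m₁ − m₁ − q•m`
lies in `F` and is fixed, so `d • n = 0`; `m' := d • m₁`. No stability of `F`, no divisibility, no CM hypothesis.
[cite: SerreLocalFields1979, XIII §1 (H¹ of a procyclic group = coinvariants)] [cite: NeukirchSchmidtWingberg2008, (1.7.7)] -/
theorem exists_fixed_and_mul_smul_eq_smul_sub (I' : Subgroup G) (φ : G)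
    (hφ : ∀ m : A, (∀ x ∈ I', x • m = m) → ∀ x ∈ I', x • (φ • m) = φ • m)
    (F : AddSubgroup A) {d q : ℕ}
    (hF : ∀ n ∈ F, (∀ x ∈ I', x • n = n) → d • n = 0)
    (hu : ∀ m : A, ∃ j : ℤ, φ • (j • m) - j • m - q • m ∈ F)
    (m : A) (hm : ∀ x ∈ I', x • m = m) :
    ∃ m' : A, (∀ x ∈ I', x • m' = m') ∧ (d * q) • m = φ • m' - m' := by
  obtain ⟨j, hj⟩ := hu m
  -- `m₁ := j • m` is fixed, and so is `n := φ • m₁ − m₁ − q • m ∈ F`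
  have hm₁ : ∀ x ∈ I', x • (j • m) = j • m := fun x hx ↦ by rw [smul_comm, hm x hx]
  have hnfix : ∀ x ∈ I', x • (φ • (j • m) - j • m - q • m) = φ • (j • m) - j • m - q • m := fun x hx ↦ by
    rw [smul_sub, smul_sub, hφ (j • m) hm₁ x hx, hm₁ x hx, smul_comm x q m, hm x hx]
  have hd : d • (φ • (j • m) - j • m - q • m) = 0 := hF _ hj hnfix
  refine ⟨d • (j • m), fun x hx ↦ by rw [smul_comm, hm₁ x hx], ?_⟩
  rw [smul_sub, smul_sub, sub_eq_zero] at hd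
  rw [mul_nsmul', smul_comm φ d (j • m)]
  exact hd.symm

/-- ★ **The `p = 2` reading** of the abstract coinvariant bound: if some `τ ∈ I′` acts as `−1` on `F` (hτ) then every `I′`-fixed
element of `F` is killed by `2` (`n = τ • n = −n`); with `q = 2^v` in (hu) every `I′`-fixed `m` has
`2^{v+1} • m = φ • m' − m'` with `m'` fixed. On the habitat: `A = E[2^∞]`, `I′ = Gal(K̄/K̃_∞) ∩ I_{v̄}`, `F = Ê[2^∞]`, `χ_cyc(τ) = −1`,
`φ` a Frobenius lift acting on `Ẽ[2^∞]` by `u` with `u − 1 = 2^v · odd`. [cite: SerreLocalFields1979, XIII §1]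
[cite: GreenbergLNM1716, §2 (ordinary filtration at p)] -/
theorem exists_fixed_and_two_pow_succ_smul_eq_smul_sub (I' : Subgroup G) (φ : G)
    (hφ : ∀ m : A, (∀ x ∈ I', x • m = m) → ∀ x ∈ I', x • (φ • m) = φ • m)
    (F : AddSubgroup A) (hτ : ∃ τ ∈ I', ∀ n ∈ F, τ • n = -n) {v : ℕ}
    (hu : ∀ m : A, ∃ j : ℤ, φ • (j • m) - j • m - 2 ^ v • m ∈ F)
    (m : A) (hm : ∀ x ∈ I', x • m = m) :
    ∃ m' : A, (∀ x ∈ I', x • m' = m') ∧ 2 ^ (v + 1) • m = φ • m' - m' := by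
  obtain ⟨τ, hτI, hτF⟩ := hτ
  have hF : ∀ n ∈ F, (∀ x ∈ I', x • n = n) → 2 • n = 0 := fun n hn hfix ↦ by
    have h1 : τ • n = n := hfix τ hτI
    rw [hτF n hn] at h1
    rw [two_nsmul]
    nth_rw 1 [← h1]
    exact neg_add_cancel n
  rw [pow_succ']
  exact exists_fixed_and_mul_smul_eq_smul_sub I' φ hφ F hF hu m hm

end Coinv

/-! ## §2. The curve-level discharge of `hcoinv`, and the door from `hgen` + `hord` -/

section Curve

variable {K : Type} [Field K] [NumberField K] (W : WeierstrassCurve K) (vbar : HeightOneSpectrum (𝓞 K))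

/-- An element `φ` of the decomposition group `D_{v̄}` NORMALISES `I′ = pairKer κ₁ κ₂ ∩ I_{v̄}` (`pairKer ⊴ Γ_K`, `I_{v̄} ⊴ D_{v̄}`:
`SignedEC.SharpEigen.inertiaIn_normal`), hence maps `I′`-fixed points of any `Γ_K`-module to `I′`-fixed points.
[cite: NeukirchSchmidtWingberg2008, (7.5.2)] -/
theorem smul_smul_eq_of_mem_decomp {p : ℕ} [Fact p.Prime] (κ₁ κ₂ : ZpExtension K p)
    {A : Type*} [AddCommGroup A] [DistribMulAction (absoluteGaloisGroup K) A]
    {φ : absoluteGaloisGroup K} (hφ : φ ∈ decomp vbar) (m : A)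
    (hm : ∀ x : absoluteGaloisGroup K, x ∈ ZpExtension.pairKer κ₁ κ₂ → x ∈ inertia vbar → x • m = m)
    (x : absoluteGaloisGroup K) (hxP : x ∈ ZpExtension.pairKer κ₁ κ₂) (hxI : x ∈ inertia vbar) :
    x • (φ • m) = φ • m := by
  haveI hN : (inertiaIn (ZpExtension.pairKer κ₁ κ₂) vbar).Normal :=
    SignedEC.SharpEigen.inertiaIn_normal (ZpExtension.pairKer κ₁ κ₂) vbar
  refine smul_smul_eq_of_conj_mem (ZpExtension.pairKer κ₁ κ₂ ⊓ inertia vbar) φ (fun y hy ↦ ?_) m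
    (fun y hy ↦ hm y (Subgroup.mem_inf.1 hy).1 (Subgroup.mem_inf.1 hy).2) x (Subgroup.mem_inf.2 ⟨hxP, hxI⟩)
  obtain ⟨hyP, hyI⟩ := Subgroup.mem_inf.1 hy
  have hyD : y ∈ decomp (K := K) vbar := inertia_le_decomp vbar hyI
  have h := hN.conj_mem' ⟨y, hyD⟩ ((mem_inertiaIn_iff _ vbar _).2 ⟨hyP, hyI⟩) ⟨φ, hφ⟩
  exact Subgroup.mem_inf.2 ((mem_inertiaIn_iff _ vbar _).1 h)

/-- **`hcoinv` from a two-exponent shape, any `p`.** If some additive subgroup `F ≤ E[p^∞]` has its `I′`-fixed elements killed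
by `p^a` (`I′ = pairKer κ₁ κ₂ ∩ I_{v̄}`) and every `m ∈ E[p^∞]` has an integer multiple with `φ • (j • m) − j • m − p^b • m ∈ F`
(`φ ∈ D_{v̄}`), then the `φ`-coinvariants of `E[p^∞]^{I′}` are killed by `p^{a+b}` — the hypothesis `hcoinv` of
`acLineControl_of_localCoinvExponent`. (At odd `p` on an ordinary curve: `F = Ê[p^∞]`, `a = 0` when `χ_cyc(I′) ⊄ 1 + p ℤ_p`-fixed
part is trivial, `b = v_p(u − 1)`.) [cite: SerreLocalFields1979, XIII §1] [cite: GreenbergLNM1716, §2] -/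
theorem coinvExponent_of_shape (p : ℕ) [Fact p.Prime] (κ₁ κ₂ : ZpExtension K p) {φ : absoluteGaloisGroup K}
    (hφ : φ ∈ decomp vbar) {a b : ℕ}
    (hshape : ∃ F : AddSubgroup (W.geomPrimaryTorsion p),
      (∀ n ∈ F, (∀ x : absoluteGaloisGroup K, x ∈ ZpExtension.pairKer κ₁ κ₂ → x ∈ inertia vbar → x • n = n) →
        p ^ a • n = 0) ∧
      ∀ m : W.geomPrimaryTorsion p, ∃ j : ℤ, φ • (j • m) - j • m - p ^ b • m ∈ F) :
    ∃ c : ℕ, ∀ m : W.geomPrimaryTorsion p, (∀ x : absoluteGaloisGroup K,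
      x ∈ ZpExtension.pairKer κ₁ κ₂ → x ∈ inertia vbar → x • m = m) → ∃ m' : W.geomPrimaryTorsion p,
        (∀ x : absoluteGaloisGroup K, x ∈ ZpExtension.pairKer κ₁ κ₂ → x ∈ inertia vbar → x • m' = m') ∧
          p ^ c • m = φ • m' - m' := by
  obtain ⟨F, hF, hu⟩ := hshape
  refine ⟨a + b, fun m hm ↦ ?_⟩
  have key := exists_fixed_and_mul_smul_eq_smul_sub (A := W.geomPrimaryTorsion p)
    (ZpExtension.pairKer κ₁ κ₂ ⊓ inertia vbar) φ
    (fun n hn x hx ↦ smul_smul_eq_of_mem_decomp vbar κ₁ κ₂ hφ n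
      (fun y hyP hyI ↦ hn y (Subgroup.mem_inf.2 ⟨hyP, hyI⟩)) x (Subgroup.mem_inf.1 hx).1 (Subgroup.mem_inf.1 hx).2)
    F (fun n hn hfix ↦ hF n hn (fun x hxP hxI ↦ hfix x (Subgroup.mem_inf.2 ⟨hxP, hxI⟩))) hu m
    (fun x hx ↦ hm x (Subgroup.mem_inf.1 hx).1 (Subgroup.mem_inf.1 hx).2)
  obtain ⟨m', hm'fix, hm'⟩ := key
  refine ⟨m', fun x hxP hxI ↦ hm'fix x (Subgroup.mem_inf.2 ⟨hxP, hxI⟩), ?_⟩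
  rw [pow_add]
  exact hm'

/-- ★ **`hcoinv` from the ORDINARY SHAPE at `v̄`, `p = 2`** (CM allowed): ONE displayed existential over tree objects —
`hord : ∃ F ≤ E[2^∞], (∃ τ ∈ pairKer κ₁ κ₂, τ ∈ I_{v̄} ∧ τ|_F = −1) ∧ ∃ v, ∀ m, ∃ j : ℤ, φ • (j • m) − j • m − 2^v • m ∈ F` — gives:
every `I′`-fixed `m ∈ E[2^∞]` has `2^{v+1} • m = φ • m' − m'` with `m'` fixed. On paper `F = Ê[2^∞]`, `χ_cyc(τ) = −1`,
`v = v₂(α^f − 1)`; NO `D_{v̄}`-stability of `F` is needed. [cite: SerreLocalFields1979, XIII §1] [cite: GreenbergLNM1716, §2] -/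
theorem coinvExponent_of_ordinaryShape (κ₁ κ₂ : ZpExtension K 2) {φ : absoluteGaloisGroup K} (hφ : φ ∈ decomp vbar)
    (hord : ∃ F : AddSubgroup (W.geomPrimaryTorsion 2),
      (∃ τ : absoluteGaloisGroup K, τ ∈ ZpExtension.pairKer κ₁ κ₂ ∧ τ ∈ inertia vbar ∧ ∀ n ∈ F, τ • n = -n) ∧
      ∃ v : ℕ, ∀ m : W.geomPrimaryTorsion 2, ∃ j : ℤ, φ • (j • m) - j • m - 2 ^ v • m ∈ F) :
    ∃ c : ℕ, ∀ m : W.geomPrimaryTorsion 2, (∀ x : absoluteGaloisGroup K,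
      x ∈ ZpExtension.pairKer κ₁ κ₂ → x ∈ inertia vbar → x • m = m) → ∃ m' : W.geomPrimaryTorsion 2,
        (∀ x : absoluteGaloisGroup K, x ∈ ZpExtension.pairKer κ₁ κ₂ → x ∈ inertia vbar → x • m' = m') ∧
          2 ^ c • m = φ • m' - m' := by
  obtain ⟨F, ⟨τ, hτP, hτI, hτF⟩, v, hu⟩ := hord
  refine coinvExponent_of_shape W vbar 2 κ₁ κ₂ hφ (a := 1) (b := v) ⟨F, fun n hn hfix ↦ ?_, hu⟩
  have h1 : τ • n = n := hfix τ hτP hτI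
  rw [hτF n hn] at h1
  rw [pow_one, two_nsmul]
  nth_rw 1 [← h1]
  exact neg_add_cancel n

/-- ★ **AC-LINE CONTROL FROM THE ORDINARY SHAPE** (`p = 2`): `W/ℚ` elliptic, `K` imaginary quadratic, a topological generator pair,
`v̄ ∋ 2`, `φ ∈ Gal(K̄/K_∞^{(2)}) ∩ D_{v̄}` topologically generating that group modulo `I′ = Gal(K̄/K̃_∞) ∩ I_{v̄}` (`hgen`), and the
ORDINARY SHAPE `hord` (some `F ≤ E_K[2^∞]`, some `τ ∈ I′` acting as `−1` on `F`, some `v` with `φ • (j•m) − j•m − 2^v•m ∈ F`).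
Conclusion = the door's control input `hctl` at `(W.baseChange K, 2, κ₁, κ₂, v̄, γ₁)` VERBATIM — NO ¬CM, NO Serre–Tate, NO
`E(K)[2] = 0`. (`acLineControl_of_localCoinvExponent` + `coinvExponent_of_ordinaryShape`.)
[cite: SkinnerUrban2014, Prop. 3.2.8 (p. 23)] [cite: JetchevSkinnerWan2017, §3.4 (arXiv:1512.06894 pp. 14–15)]
[cite: SerreLocalFields1979, XIII §1] -/
theorem acLineControl_of_ordinaryShape (W : WeierstrassCurve ℚ) [W.IsElliptic]
    (K : Type) [Field K] [NumberField K] (hK : IsImaginaryQuadratic K)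
    (κ₁ κ₂ : ZpExtension K 2) (γ₁ γ₂ : absoluteGaloisGroup K) [Fact (ZpExtension.IsTopGeneratorPair κ₁ κ₂ γ₁ γ₂)]
    (vbar : HeightOneSpectrum (𝓞 K)) (hvbar : ((2 : ℕ) : 𝓞 K) ∈ vbar.asIdeal)
    (φ : absoluteGaloisGroup K) (hφ : φ ∈ κ₂.kerSubgroup ⊓ decomp vbar)
    (hgen : κ₂.kerSubgroup ⊓ decomp vbar ≤ (Subgroup.closure ({φ} ∪
      ((ZpExtension.pairKer κ₁ κ₂ ⊓ inertia vbar : Subgroup (absoluteGaloisGroup K)) :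
        Set (absoluteGaloisGroup K)))).topologicalClosure)
    (hord : ∃ F : AddSubgroup ((W.baseChange K).geomPrimaryTorsion 2),
      (∃ τ : absoluteGaloisGroup K, τ ∈ ZpExtension.pairKer κ₁ κ₂ ∧ τ ∈ inertia vbar ∧ ∀ n ∈ F, τ • n = -n) ∧
      ∃ v : ℕ, ∀ m : (W.baseChange K).geomPrimaryTorsion 2, ∃ j : ℤ, φ • (j • m) - j • m - 2 ^ v • m ∈ F) :
    ∃ m : ℕ, ∀ s : unrSelmer₂ κ₁ κ₂ ((W.baseChange K).geomPrimaryTorsion 2) vbar,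
      conjSel₂ κ₁ κ₂ ((W.baseChange K).geomPrimaryTorsion 2) vbar γ₁ s = s →
        2 ^ m • s ∈ Set.range ((W.baseChange K).selmerAcToUnrSelmer₂ 2 κ₁ κ₂ vbar) :=
  acLineControl_of_localCoinvExponent W 2 K hK κ₁ κ₂ γ₁ γ₂ vbar hvbar φ hφ hgen
    (coinvExponent_of_ordinaryShape (W.baseChange K) vbar κ₁ κ₂ (Subgroup.mem_inf.1 hφ).2 hord)

end Curve

/-! ## §3. The (S2) / (e15) NET SHAPES in the coinvariant currency -/

section RankOne

variable (W : WeierstrassCurve ℚ) [W.IsElliptic] [W.IsGloballyMinimal] (p : ℕ) [Fact p.Prime]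
  {K : Type} [Field K] [NumberField K]

/-- ★ **THE NET SHAPE of the AC-LINE BUDGET at rank-one data, COINVARIANT currency** (any `p`): LINK A₂'s binders (`W/ℚ` elliptic
globally minimal, `K` imaginary quadratic with `p` split, a generator pair with `κ₂` anticyclotomic, `v̄ ∋ p`, `rank E(K) = 1`,
`#Ш(E/K)[p^∞] < ∞`) + `hgen` + `hcoinv` at `v̄` + `J` ⟹ `∃ k F, ch(𝔛_ac) = (F) ∧ F(0) ≠ 0 ∧ C(p^k)·F^J ∈ π(ch_{Λ_K}(X_Gr₂)·Λ^ur)`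
(GEN 53's `acLineBudget_of_rankOne` with `hctl := acLineControl_of_localCoinvExponent …`).
[cite: JetchevSkinnerWan2017, Thm. 3.3.1 (shape) and §3.4] [cite: SkinnerUrban2014, Prop. 3.2.8 (p. 23)] -/
theorem acLineBudget_of_rankOne_of_localCoinvExponent (hK : IsImaginaryQuadratic K) (hsplit : X11b.SplitsIn K p)
    (κ₁ κ₂ : ZpExtension K p) (γ₁ γ₂ : absoluteGaloisGroup K) [Fact (ZpExtension.IsTopGeneratorPair κ₁ κ₂ γ₁ γ₂)]
    [Fact (κ₂.IsTopGenerator γ₂)] (hκ₂ : κ₂.IsAnticyclotomic)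
    (vbar : HeightOneSpectrum (𝓞 K)) (hvbar : ((p : ℕ) : 𝓞 K) ∈ vbar.asIdeal)
    (hrank : (W.baseChange K).mordellWeilRank = 1)
    (hsha : Finite (AddCommGroup.primaryComponent (W.baseChange K).sha p))
    (φ : absoluteGaloisGroup K) (hφ : φ ∈ κ₂.kerSubgroup ⊓ decomp vbar)
    (hgen : κ₂.kerSubgroup ⊓ decomp vbar ≤ (Subgroup.closure ({φ} ∪
      ((ZpExtension.pairKer κ₁ κ₂ ⊓ inertia vbar : Subgroup (absoluteGaloisGroup K)) :
        Set (absoluteGaloisGroup K)))).topologicalClosure)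
    (hcoinv : ∃ c : ℕ, ∀ m : (W.baseChange K).geomPrimaryTorsion p, (∀ x : absoluteGaloisGroup K,
      x ∈ ZpExtension.pairKer κ₁ κ₂ → x ∈ inertia vbar → x • m = m) → ∃ m' : (W.baseChange K).geomPrimaryTorsion p,
        (∀ x : absoluteGaloisGroup K, x ∈ ZpExtension.pairKer κ₁ κ₂ → x ∈ inertia vbar → x • m' = m') ∧
          p ^ c • m = φ • m' - m')
    (J : ℤ_[p] →+* PadicComplexInt p) :
    ∃ (k : ℕ) (F : IwasawaAlgebra p),
      AcSelmer.XAc.charIdeal (W.baseChange K) p κ₂ vbar ∅ γ₂ = Ideal.span {F} ∧ PowerSeries.constantCoeff F ≠ 0 ∧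
      PowerSeries.C (((p : ℕ) : PadicComplexInt p) ^ k) * PowerSeries.map J F ∈
        ((XGr₂.charIdeal (W.baseChange K) p κ₁ κ₂ vbar γ₁ γ₂).map (IwasawaAlgebra₂.toUnr₂ p J)).map
          (PowerSeries.constantCoeff (R := PowerSeries (PadicComplexInt p))) :=
  acLineBudget_of_rankOne W p hK hsplit κ₁ κ₂ γ₁ γ₂ hκ₂ vbar hvbar hrank hsha
    (acLineControl_of_localCoinvExponent W p K hK κ₁ κ₂ γ₁ γ₂ vbar hvbar φ hφ hgen hcoinv) J

/-- **NONDEG₀(ℓ_ac) + BUDGET at rank-one data, COINVARIANT currency** (any `p`; the O2 line's currency `ch_{Λ_K}(X_Gr₂) = (C₀)`):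
LINK A₂'s rank-one data + `hgen` + `hcoinv` ⟹ for every `J` and every generator `C₀`: `π(J C₀) ≠ 0`, `(J C₀)(0,0) ≠ 0`, and
`(J C₀)(0,0) ∣ p^{k+m} · u` (`m` = LINK A₂'s exponent, `u` a unit). (GEN 53's `nondeg₀_and_budget_of_rankOne_of_localExponent`
re-keyed.) [cite: JetchevSkinnerWan2017, Thm. 3.3.1 (shape) and §3.4] [cite: GreenbergLNM1716, §4 Lemma 4.2] -/
theorem nondeg₀_and_budget_of_rankOne_of_localCoinvExponent (hK : IsImaginaryQuadratic K) (hsplit : X11b.SplitsIn K p)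
    (κ₁ κ₂ : ZpExtension K p) (γ₁ γ₂ : absoluteGaloisGroup K) [Fact (ZpExtension.IsTopGeneratorPair κ₁ κ₂ γ₁ γ₂)]
    [Fact (κ₂.IsTopGenerator γ₂)] (hκ₂ : κ₂.IsAnticyclotomic)
    (vbar : HeightOneSpectrum (𝓞 K)) (hvbar : ((p : ℕ) : 𝓞 K) ∈ vbar.asIdeal)
    (hrank : (W.baseChange K).mordellWeilRank = 1)
    (hsha : Finite (AddCommGroup.primaryComponent (W.baseChange K).sha p))
    (φ : absoluteGaloisGroup K) (hφ : φ ∈ κ₂.kerSubgroup ⊓ decomp vbar)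
    (hgen : κ₂.kerSubgroup ⊓ decomp vbar ≤ (Subgroup.closure ({φ} ∪
      ((ZpExtension.pairKer κ₁ κ₂ ⊓ inertia vbar : Subgroup (absoluteGaloisGroup K)) :
        Set (absoluteGaloisGroup K)))).topologicalClosure)
    (hcoinv : ∃ c : ℕ, ∀ m : (W.baseChange K).geomPrimaryTorsion p, (∀ x : absoluteGaloisGroup K,
      x ∈ ZpExtension.pairKer κ₁ κ₂ → x ∈ inertia vbar → x • m = m) → ∃ m' : (W.baseChange K).geomPrimaryTorsion p,
        (∀ x : absoluteGaloisGroup K, x ∈ ZpExtension.pairKer κ₁ κ₂ → x ∈ inertia vbar → x • m' = m') ∧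
          p ^ c • m = φ • m' - m')
    (J : ℤ_[p] →+* PadicComplexInt p) (C₀ : IwasawaAlgebra₂ p)
    (hC₀ : XGr₂.charIdeal (W.baseChange K) p κ₁ κ₂ vbar γ₁ γ₂ = Ideal.span {C₀}) :
    PowerSeries.constantCoeff (IwasawaAlgebra₂.toUnr₂ p J C₀) ≠ 0 ∧
      PowerSeries.constantCoeff (PowerSeries.constantCoeff (IwasawaAlgebra₂.toUnr₂ p J C₀)) ≠ 0 ∧
      ∃ (m k : ℕ) (u : PadicComplexInt p), AcSelmer.XAc.HasCharValuationAt (W.baseChange K) p κ₂ vbar ∅ γ₂ m ∧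
        IsUnit u ∧ PowerSeries.constantCoeff (PowerSeries.constantCoeff (IwasawaAlgebra₂.toUnr₂ p J C₀)) ∣
          ((p : ℕ) : PadicComplexInt p) ^ (k + m) * u := by
  haveI : (W.baseChange K).IsElliptic := by rw [baseChange]; infer_instance
  obtain ⟨m, hm⟩ := hasCharValuationAt_of_rankOne W p hK hsplit κ₂ hκ₂ γ₂ vbar hvbar hrank hsha
  have hctl := acLineControl_of_localCoinvExponent W p K hK κ₁ κ₂ γ₁ γ₂ vbar hvbar φ hφ hgen hcoinv
  obtain ⟨h1, h2⟩ := constantCoeff_toUnr₂_ne_zero_of_hasCharValuationAt (W.baseChange K) p κ₁ κ₂ vbar γ₁ γ₂ hm hctl J C₀ hC₀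
  obtain ⟨k, u, hu, hdvd⟩ := exists_dvd_pow_mul_unit_of_hasCharValuationAt (W.baseChange K) p κ₁ κ₂ vbar γ₁ γ₂ hm hctl
    J C₀ hC₀
  exact ⟨h1, h2, m, k, u, hm, hu, hdvd⟩

/-- **THE NET SHAPE of the AC-LINE BUDGET at rank-one data from the ORDINARY SHAPE** (`p = 2`): LINK A₂'s binders + `hgen` + `hord`
+ `J` ⟹ `∃ k F, ch(𝔛_ac) = (F) ∧ F(0) ≠ 0 ∧ C(2^k)·F^J ∈ π(ch_{Λ_K}(X_Gr₂)·Λ^ur)`.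
[cite: JetchevSkinnerWan2017, Thm. 3.3.1 (shape) and §3.4] [cite: SkinnerUrban2014, Prop. 3.2.8 (p. 23)] -/
theorem acLineBudget_of_rankOne_of_ordinaryShape (hK : IsImaginaryQuadratic K) (hsplit : X11b.SplitsIn K 2)
    (κ₁ κ₂ : ZpExtension K 2) (γ₁ γ₂ : absoluteGaloisGroup K) [Fact (ZpExtension.IsTopGeneratorPair κ₁ κ₂ γ₁ γ₂)]
    [Fact (κ₂.IsTopGenerator γ₂)] (hκ₂ : κ₂.IsAnticyclotomic)
    (vbar : HeightOneSpectrum (𝓞 K)) (hvbar : ((2 : ℕ) : 𝓞 K) ∈ vbar.asIdeal)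
    (hrank : (W.baseChange K).mordellWeilRank = 1)
    (hsha : Finite (AddCommGroup.primaryComponent (W.baseChange K).sha 2))
    (φ : absoluteGaloisGroup K) (hφ : φ ∈ κ₂.kerSubgroup ⊓ decomp vbar)
    (hgen : κ₂.kerSubgroup ⊓ decomp vbar ≤ (Subgroup.closure ({φ} ∪
      ((ZpExtension.pairKer κ₁ κ₂ ⊓ inertia vbar : Subgroup (absoluteGaloisGroup K)) :
        Set (absoluteGaloisGroup K)))).topologicalClosure)
    (hord : ∃ F : AddSubgroup ((W.baseChange K).geomPrimaryTorsion 2),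
      (∃ τ : absoluteGaloisGroup K, τ ∈ ZpExtension.pairKer κ₁ κ₂ ∧ τ ∈ inertia vbar ∧ ∀ n ∈ F, τ • n = -n) ∧
      ∃ v : ℕ, ∀ m : (W.baseChange K).geomPrimaryTorsion 2, ∃ j : ℤ, φ • (j • m) - j • m - 2 ^ v • m ∈ F)
    (J : ℤ_[2] →+* PadicComplexInt 2) :
    ∃ (k : ℕ) (F : IwasawaAlgebra 2),
      AcSelmer.XAc.charIdeal (W.baseChange K) 2 κ₂ vbar ∅ γ₂ = Ideal.span {F} ∧ PowerSeries.constantCoeff F ≠ 0 ∧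
      PowerSeries.C (((2 : ℕ) : PadicComplexInt 2) ^ k) * PowerSeries.map J F ∈
        ((XGr₂.charIdeal (W.baseChange K) 2 κ₁ κ₂ vbar γ₁ γ₂).map (IwasawaAlgebra₂.toUnr₂ 2 J)).map
          (PowerSeries.constantCoeff (R := PowerSeries (PadicComplexInt 2))) :=
  acLineBudget_of_rankOne W 2 hK hsplit κ₁ κ₂ γ₁ γ₂ hκ₂ vbar hvbar hrank hsha
    (acLineControl_of_ordinaryShape W K hK κ₁ κ₂ γ₁ γ₂ vbar hvbar φ hφ hgen hord) J

end RankOne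

section Inequality

variable (W : WeierstrassCurve ℚ) [W.IsElliptic] [W.IsGloballyMinimal]
  {K : Type} [Field K] [NumberField K]
  (κ₁ κ₂ : ZpExtension K 2) (vbar : HeightOneSpectrum (𝓞 K)) (γ₁ γ₂ : absoluteGaloisGroup K)
  [Fact (ZpExtension.IsTopGeneratorPair κ₁ κ₂ γ₁ γ₂)] [Fact (κ₂.IsTopGenerator γ₂)]
  -- the pinning datum of the O2 line, UNFOLDED as in ACPIN-NEC (p781951) and GEN 53's budget file: `FibrePinned G (toUnr₂ 2 J C₀)`,
  -- the W⁺ reading `G(0,0) ∈ 𝔪`, and a content decomposition `toUnr₂ 2 J C₀ = 2^a · C₁` with `red C₁ ≠ 0`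
  (J : ℤ_[2] →+* PadicComplexInt 2) (C₀ : IwasawaAlgebra₂ 2) (G : PowerSeries (PowerSeries (PadicComplexInt 2)))
  (hpin : ∃ 𝔓 : Ideal (PowerSeries (PowerSeries (IsLocalRing.ResidueField (PadicComplexInt 2)))),
    𝔓.IsPrime ∧ PowerSeries.map (PowerSeries.map (IsLocalRing.residue (PadicComplexInt 2))) G ∉ 𝔓 ∧
    ∀ (a : ℕ) (C₁ : PowerSeries (PowerSeries (PadicComplexInt 2))),
      IwasawaAlgebra₂.toUnr₂ 2 J C₀ = (2 : PowerSeries (PowerSeries (PadicComplexInt 2))) ^ a * C₁ →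
      PowerSeries.map (PowerSeries.map (IsLocalRing.residue (PadicComplexInt 2))) C₁ ≠ 0 →
      PowerSeries.map (PowerSeries.map (IsLocalRing.residue (PadicComplexInt 2))) C₁ ∈
        𝔓 ⊔ Ideal.span {PowerSeries.map (PowerSeries.map (IsLocalRing.residue (PadicComplexInt 2))) G})
  (hG0 : PowerSeries.constantCoeff (PowerSeries.constantCoeff G) ∈ IsLocalRing.maximalIdeal (PadicComplexInt 2))
  (a : ℕ) (C₁ : PowerSeries (PowerSeries (PadicComplexInt 2)))
  (hC : IwasawaAlgebra₂.toUnr₂ 2 J C₀ = (2 : PowerSeries (PowerSeries (PadicComplexInt 2))) ^ a * C₁)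
  (hC₁ : PowerSeries.map (PowerSeries.map (IsLocalRing.residue (PadicComplexInt 2))) C₁ ≠ 0)

include hpin hG0 hC hC₁

/-- ★ **(e15) ON THE HABITAT'S RANK-ONE DATA, COINVARIANT currency** (`p = 2`): the pinning datum (`FibrePinned G (toUnr₂ 2 J C₀)`
unfolded, W⁺ reading `G(0,0) ∈ 𝔪`, content `toUnr₂ 2 J C₀ = 2^a · C₁` with `red C₁ ≠ 0`) for `E_K = W.baseChange K`, LINK A₂'s
binders, `hgen` + `hcoinv` at `v̄`, `ch_{Λ_K}(X_Gr₂) = (C₀)`: there are the LINK A₂ exponent `m`, a door exponent `k` and a unit `u`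
with `(J C₀)(0,0) ∣ 2^{k+m}·u` and **`1 + a ≤ k + m`** — «pinning needs Selmer budget at the origin», now modulo `hgen` + `hcoinv`
instead of `hfixc`. [folklore] -/
theorem one_add_le_of_fibrePinned_of_rankOne_of_localCoinvExponent (hK : IsImaginaryQuadratic K)
    (hsplit : X11b.SplitsIn K 2) (hκ₂ : κ₂.IsAnticyclotomic) (hvbar : ((2 : ℕ) : 𝓞 K) ∈ vbar.asIdeal)
    (hrank : (W.baseChange K).mordellWeilRank = 1)
    (hsha : Finite (AddCommGroup.primaryComponent (W.baseChange K).sha 2))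
    (φ : absoluteGaloisGroup K) (hφ : φ ∈ κ₂.kerSubgroup ⊓ decomp vbar)
    (hgen : κ₂.kerSubgroup ⊓ decomp vbar ≤ (Subgroup.closure ({φ} ∪
      ((ZpExtension.pairKer κ₁ κ₂ ⊓ inertia vbar : Subgroup (absoluteGaloisGroup K)) :
        Set (absoluteGaloisGroup K)))).topologicalClosure)
    (hcoinv : ∃ c : ℕ, ∀ m : (W.baseChange K).geomPrimaryTorsion 2, (∀ x : absoluteGaloisGroup K,
      x ∈ ZpExtension.pairKer κ₁ κ₂ → x ∈ inertia vbar → x • m = m) → ∃ m' : (W.baseChange K).geomPrimaryTorsion 2,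
        (∀ x : absoluteGaloisGroup K, x ∈ ZpExtension.pairKer κ₁ κ₂ → x ∈ inertia vbar → x • m' = m') ∧
          2 ^ c • m = φ • m' - m')
    (hC₀ : XGr₂.charIdeal (W.baseChange K) 2 κ₁ κ₂ vbar γ₁ γ₂ = Ideal.span {C₀}) :
    ∃ (m k : ℕ) (u : PadicComplexInt 2), AcSelmer.XAc.HasCharValuationAt (W.baseChange K) 2 κ₂ vbar ∅ γ₂ m ∧
      IsUnit u ∧ PowerSeries.constantCoeff (PowerSeries.constantCoeff (IwasawaAlgebra₂.toUnr₂ 2 J C₀)) ∣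
        (2 : PadicComplexInt 2) ^ (k + m) * u ∧ 1 + a ≤ k + m := by
  haveI : (W.baseChange K).IsElliptic := by rw [baseChange]; infer_instance
  obtain ⟨m, hm⟩ := hasCharValuationAt_of_rankOne W 2 hK hsplit κ₂ hκ₂ γ₂ vbar hvbar hrank hsha
  have hctl := acLineControl_of_localCoinvExponent W 2 K hK κ₁ κ₂ γ₁ γ₂ vbar hvbar φ hφ hgen hcoinv
  obtain ⟨k, u, hu, hdvd, hle⟩ := one_add_le_of_fibrePinned_of_hasCharValuationAt (W.baseChange K) κ₁ κ₂ vbar γ₁ γ₂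
    J C₀ G hpin hG0 a C₁ hC hC₁ hm hctl hC₀
  exact ⟨m, k, u, hm, hu, hdvd, hle⟩

/-- ★ **(e15) ON THE HABITAT'S RANK-ONE DATA FROM THE ORDINARY SHAPE** (`p = 2`): the pinning datum, LINK A₂'s binders, `hgen` and
the ordinary shape `hord` at `v̄`, `ch_{Λ_K}(X_Gr₂) = (C₀)`: there are `m`, `k` and a unit `u` with `(J C₀)(0,0) ∣ 2^{k+m}·u` and
**`1 + a ≤ k + m`** — a pinned W⁺ datum with `k + m = 0` is IMPOSSIBLE, now modulo two ELEMENTARY displayed local hypotheses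
(`hgen`: `Q` procyclic on `φ`; `hord`: ordinary shape), CM allowed, no Serre–Tate. [folklore] -/
theorem one_add_le_of_fibrePinned_of_rankOne_of_ordinaryShape (hK : IsImaginaryQuadratic K)
    (hsplit : X11b.SplitsIn K 2) (hκ₂ : κ₂.IsAnticyclotomic) (hvbar : ((2 : ℕ) : 𝓞 K) ∈ vbar.asIdeal)
    (hrank : (W.baseChange K).mordellWeilRank = 1)
    (hsha : Finite (AddCommGroup.primaryComponent (W.baseChange K).sha 2))
    (φ : absoluteGaloisGroup K) (hφ : φ ∈ κ₂.kerSubgroup ⊓ decomp vbar)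
    (hgen : κ₂.kerSubgroup ⊓ decomp vbar ≤ (Subgroup.closure ({φ} ∪
      ((ZpExtension.pairKer κ₁ κ₂ ⊓ inertia vbar : Subgroup (absoluteGaloisGroup K)) :
        Set (absoluteGaloisGroup K)))).topologicalClosure)
    (hord : ∃ F : AddSubgroup ((W.baseChange K).geomPrimaryTorsion 2),
      (∃ τ : absoluteGaloisGroup K, τ ∈ ZpExtension.pairKer κ₁ κ₂ ∧ τ ∈ inertia vbar ∧ ∀ n ∈ F, τ • n = -n) ∧
      ∃ v : ℕ, ∀ m : (W.baseChange K).geomPrimaryTorsion 2, ∃ j : ℤ, φ • (j • m) - j • m - 2 ^ v • m ∈ F)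
    (hC₀ : XGr₂.charIdeal (W.baseChange K) 2 κ₁ κ₂ vbar γ₁ γ₂ = Ideal.span {C₀}) :
    ∃ (m k : ℕ) (u : PadicComplexInt 2), AcSelmer.XAc.HasCharValuationAt (W.baseChange K) 2 κ₂ vbar ∅ γ₂ m ∧
      IsUnit u ∧ PowerSeries.constantCoeff (PowerSeries.constantCoeff (IwasawaAlgebra₂.toUnr₂ 2 J C₀)) ∣
        (2 : PadicComplexInt 2) ^ (k + m) * u ∧ 1 + a ≤ k + m :=
  one_add_le_of_fibrePinned_of_rankOne_of_localCoinvExponent W κ₁ κ₂ vbar γ₁ γ₂ J C₀ G hpin hG0 a C₁ hC hC₁ hK hsplit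
    hκ₂ hvbar hrank hsha φ hφ hgen (coinvExponent_of_ordinaryShape (W.baseChange K) vbar κ₁ κ₂ (Subgroup.mem_inf.1 hφ).2 hord)
    hC₀

end Inequality

end Summit.BirchSwinnertonDyer.BirchSwinnertonDyer.Theorems.TwoAdicBDPAcLineSpec

end
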